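import Mathlib
import Literature.Analysis.FluidPDE.TypeIICoreWitness
import Summits.NavierStokesRegularity.NavierStokesRegularity.Theorems.TypeIIInviscidRelaxationCoreExclusionAnchorReductionColumnar
import Summits.NavierStokesRegularity.NavierStokesRegularity.Theorems.TypeIIInviscidRelaxationCoreExclusionAnchorReductionAxisym
import HarnessLib

/-!
# Cruxes `ColumnarCoreExclusion` (stmt-1966) / `MonopoleCoreExclusion` (stmt-1965): at the EULER RATE the anchor stubs
# reduce to LATENESS ALONE

`--supports stmt-NavierStokesRegularity-1966` (helper file; theorems only, no definitions, no `sorry`).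

Positive counterpart of the obstruction certificates `…CoreExclusionAnchorObstructionLate` (p832667) /
`…MonopoleCoreExclusionAnchorObstructionLate` (p832781), which showed that in the INTERMEDIATE-rate regime
`(T-t)^{-1/2} ≪ ‖u(t)‖_∞ ≪ (T-t)^{-1}` late witnesses need not have a core-radius floor (so the floor hypothesis of
`CoreExclusionAnchor.anchoredLateWitness_of_lateWitnesses_radiusFloor`, p831087, cannot be dropped in general).  Here:
if the blow-up has the EULER RATE at the witness times — the speed bound satisfies `(T-t)·V ≥ r₀` for a fixed
`r₀ > 0`, in particular if `(T-t)·‖u(t)‖_∞ ≥ r₀` on `[0,T)` (the scaling regime the route's thesis posits: "Type II ⇔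
local Reynolds number → ∞, the zoom at the core scale is Euler") — then a LATE witness automatically has core radius
`K·L ≥ (T-t)·V ≥ r₀`, and p831087 gives the full conclusion of the registered anchor stubs: a singular anchor `xs` and
anchored late level-`K` witnesses for every `K > 0`.

* `CoreExclusionAnchor.anchoredLateWitness_of_lateWitnesses_eulerRate` (class-generic, dilation-stable class `C`);
* `…_columnar` / `…_axisym`: the two stubs' classes, in their binder shape with `hw` replaced by
  "late witnesses at every level frequently" plus the Euler-rate hypothesis
  `∃ r₀ > 0, ∀ t ∈ [0,T), ∃ x, r₀ ≤ (T-t)·‖u(t,x)‖`.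

So a re-lined anchor stub in the currency "late witnesses" is PROVED in the Euler-rate regime and carries exactly the
floor as extra load in the intermediate regime.  Nothing about Navier–Stokes regularity is claimed; no crux is proved.
-/

noncomputable section

open Set Metric
open Literature.Analysis Literature.Analysis.FluidPDE

namespace Summit.NavierStokesRegularity.NavierStokesRegularity.Theorems

-- the problem directory repeats the summit name (`NavierStokesRegularity/NavierStokesRegularity`)
set_option linter.dupNamespace false

namespace CoreExclusionAnchor

/-- **Anchored late witnesses from late witnesses at the Euler rate** (class-generic).  Let `C` be stable under
dilations `W ↦ W(c·)`, `c ≥ 1`; let `(u,p)` be a maximal smooth solution on `[0,T)`, Leray–Hopf from a rapidly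
decaying datum, with the Euler-rate lower bound `∃ r₀ > 0, ∀ t ∈ [0,T), ∃ x, r₀ ≤ (T-t)‖u(t,x)‖`; assume LATE class-`C`
witnesses occur at every level `K > 0` frequently before `T`.  Then there is a singular point `xs` and, for every
`K > 0`, a late level-`K` class-`C` witness anchored at `xs` (`dist xs x₀ ≤ KL/4`).  Proof: lateness and the rate give
the floor `KL ≥ (T-t)V ≥ r₀`; apply `anchoredLateWitness_of_lateWitnesses_radiusFloor`. [folklore] -/
theorem anchoredLateWitness_of_lateWitnesses_eulerRate
    {C : (EuclideanSpace ℝ (Fin 3) → EuclideanSpace ℝ (Fin 3)) → Prop}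
    (hC : ∀ W, C W → ∀ c : ℝ, 1 ≤ c → C (fun y => W (c • y)))
    {ν T : ℝ} {u : ℝ → EuclideanSpace ℝ (Fin 3) → EuclideanSpace ℝ (Fin 3)}
    {p : ℝ → EuclideanSpace ℝ (Fin 3) → ℝ}
    (hν : 0 < ν) (hT : 0 < T) (hmax : IsMaximalSmoothSolution ν 0 u p T)
    (hLH : IsLerayHopfOn T ν 0 (u 0) u) (hdec : HasRapidSpatialDecay (u 0))
    (hrate : ∃ r₀ : ℝ, 0 < r₀ ∧ ∀ t ∈ Ico 0 T, ∃ x, r₀ ≤ (T - t) * ‖u t x‖)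
    (hwlate : ∀ K : ℝ, 0 < K → ∀ t₀ < T, ∃ t, t₀ < t ∧ t < T ∧
      ∃ (x₀ : EuclideanSpace ℝ (Fin 3)) (L V : ℝ)
        (Q : EuclideanSpace ℝ (Fin 3) ≃ₗᵢ[ℝ] EuclideanSpace ℝ (Fin 3))
        (W : EuclideanSpace ℝ (Fin 3) → EuclideanSpace ℝ (Fin 3)),
        0 < L ∧ 0 < V ∧ C W ∧ (∀ x, ‖u t x‖ ≤ V) ∧
        (∃ x₁, dist x₁ x₀ ≤ L ∧ V ≤ 2 * ‖u t x₁‖) ∧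
        (∃ y y' : EuclideanSpace ℝ (Fin 3), ‖y‖ ≤ 1 ∧ ‖y'‖ ≤ 1 ∧ (4 : ℝ)⁻¹ ≤ ‖W y - W y'‖) ∧
        K * ν ≤ L * V ∧
        (∀ y : EuclideanSpace ℝ (Fin 3), ‖y‖ ≤ K →
          ‖V⁻¹ • Q.symm (u t (x₀ + L • Q y)) - W y‖ ≤ K⁻¹) ∧
        (T - t) * V ≤ K * L) :
    ∃ xs : EuclideanSpace ℝ (Fin 3),
      (¬ ∃ ρ M : ℝ, 0 < ρ ∧ ∀ s ∈ Ioo (T - ρ ^ 2) T, ∀ x ∈ ball xs ρ, ‖u s x‖ ≤ M) ∧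
      ∀ K : ℝ, 0 < K → ∃ t : ℝ, 0 < t ∧ t < T ∧
        ∃ (x₀ : EuclideanSpace ℝ (Fin 3)) (L V : ℝ)
          (Q : EuclideanSpace ℝ (Fin 3) ≃ₗᵢ[ℝ] EuclideanSpace ℝ (Fin 3))
          (W : EuclideanSpace ℝ (Fin 3) → EuclideanSpace ℝ (Fin 3)),
          0 < L ∧ 0 < V ∧ C W ∧ (∀ x, ‖u t x‖ ≤ V) ∧
          (∃ x₁, dist x₁ x₀ ≤ L ∧ V ≤ 2 * ‖u t x₁‖) ∧
          (∃ y y' : EuclideanSpace ℝ (Fin 3), ‖y‖ ≤ 1 ∧ ‖y'‖ ≤ 1 ∧ (4 : ℝ)⁻¹ ≤ ‖W y - W y'‖) ∧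
          K * ν ≤ L * V ∧
          (∀ y : EuclideanSpace ℝ (Fin 3), ‖y‖ ≤ K →
            ‖V⁻¹ • Q.symm (u t (x₀ + L • Q y)) - W y‖ ≤ K⁻¹) ∧
          (T - t) * V ≤ K * L ∧ dist xs x₀ ≤ K * L / 4 := by
  obtain ⟨r₀, hr₀, hrate⟩ := hrate
  refine anchoredLateWitness_of_lateWitnesses_radiusFloor hC hν hT hmax hLH hdec ⟨r₀, hr₀, ?_⟩
  intro K hK t₀ ht₀
  obtain ⟨t, ht₀t, htT, x₀, L, V, Q, W, hL, hV, hW, hbd, hnear, hosc, hRe, hclose, hlate⟩ :=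
    hwlate K hK (max t₀ 0) (max_lt ht₀ hT)
  have ht0 : 0 ≤ t := (le_max_right t₀ 0).trans ht₀t.le
  refine ⟨t, (le_max_left t₀ 0).trans_lt ht₀t, htT, x₀, L, V, Q, W, hL, hV, hW, hbd, hnear, hosc, hRe, hclose,
    hlate, ?_⟩
  -- the floor: `r₀ ≤ (T - t)‖u t x‖ ≤ (T - t) V ≤ K L`
  obtain ⟨x, hx⟩ := hrate t ⟨ht0, htT⟩
  have h1 : (T - t) * ‖u t x‖ ≤ (T - t) * V := mul_le_mul_of_nonneg_left (hbd x) (sub_pos.2 htT).le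
  exact hx.trans (h1.trans hlate)

/-- **Crux `ColumnarCoreExclusion` (stmt-1966): at the Euler rate the anchor stub needs only late columnar witnesses.**
Binder shape of `stub_anchoredLateColumnarWitness` with `hw` replaced by late columnar witnesses at every level
frequently (`hwlate`) and the Euler-rate hypothesis (`hrate`). [folklore] -/
theorem anchoredLateColumnarWitness_of_lateWitnesses_eulerRate {ν T : ℝ}
    {u : ℝ → EuclideanSpace ℝ (Fin 3) → EuclideanSpace ℝ (Fin 3)}
    {p : ℝ → EuclideanSpace ℝ (Fin 3) → ℝ}
    (hν : 0 < ν) (hT : 0 < T) (hmax : IsMaximalSmoothSolution ν 0 u p T)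
    (hLH : IsLerayHopfOn T ν 0 (u 0) u) (hdec : HasRapidSpatialDecay (u 0))
    (hrate : ∃ r₀ : ℝ, 0 < r₀ ∧ ∀ t ∈ Ico 0 T, ∃ x, r₀ ≤ (T - t) * ‖u t x‖)
    (hwlate : ∀ K : ℝ, 0 < K → ∀ t₀ < T, ∃ t, t₀ < t ∧ t < T ∧
      ∃ (x₀ : EuclideanSpace ℝ (Fin 3)) (L V : ℝ)
        (Q : EuclideanSpace ℝ (Fin 3) ≃ₗᵢ[ℝ] EuclideanSpace ℝ (Fin 3))
        (W : EuclideanSpace ℝ (Fin 3) → EuclideanSpace ℝ (Fin 3)),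
        0 < L ∧ 0 < V ∧ IsColumnar W ∧ (∀ x, ‖u t x‖ ≤ V) ∧
        (∃ x₁, dist x₁ x₀ ≤ L ∧ V ≤ 2 * ‖u t x₁‖) ∧
        (∃ y y' : EuclideanSpace ℝ (Fin 3), ‖y‖ ≤ 1 ∧ ‖y'‖ ≤ 1 ∧ (4 : ℝ)⁻¹ ≤ ‖W y - W y'‖) ∧
        K * ν ≤ L * V ∧
        (∀ y : EuclideanSpace ℝ (Fin 3), ‖y‖ ≤ K →
          ‖V⁻¹ • Q.symm (u t (x₀ + L • Q y)) - W y‖ ≤ K⁻¹) ∧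
        (T - t) * V ≤ K * L) :
    ∃ xs : EuclideanSpace ℝ (Fin 3),
      (¬ ∃ ρ M : ℝ, 0 < ρ ∧ ∀ s ∈ Ioo (T - ρ ^ 2) T, ∀ x ∈ ball xs ρ, ‖u s x‖ ≤ M) ∧
      ∀ K : ℝ, 0 < K → ∃ t : ℝ, 0 < t ∧ t < T ∧
        ∃ (x₀ : EuclideanSpace ℝ (Fin 3)) (L V : ℝ)
          (Q : EuclideanSpace ℝ (Fin 3) ≃ₗᵢ[ℝ] EuclideanSpace ℝ (Fin 3))
          (W : EuclideanSpace ℝ (Fin 3) → EuclideanSpace ℝ (Fin 3)),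
          0 < L ∧ 0 < V ∧ IsColumnar W ∧ (∀ x, ‖u t x‖ ≤ V) ∧
          (∃ x₁, dist x₁ x₀ ≤ L ∧ V ≤ 2 * ‖u t x₁‖) ∧
          (∃ y y' : EuclideanSpace ℝ (Fin 3), ‖y‖ ≤ 1 ∧ ‖y'‖ ≤ 1 ∧ (4 : ℝ)⁻¹ ≤ ‖W y - W y'‖) ∧
          K * ν ≤ L * V ∧
          (∀ y : EuclideanSpace ℝ (Fin 3), ‖y‖ ≤ K →
            ‖V⁻¹ • Q.symm (u t (x₀ + L • Q y)) - W y‖ ≤ K⁻¹) ∧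
          (T - t) * V ≤ K * L ∧ dist xs x₀ ≤ K * L / 4 :=
  anchoredLateWitness_of_lateWitnesses_eulerRate (C := IsColumnar)
    (fun _ hW c _ => isColumnar_dilate hW c) hν hT hmax hLH hdec hrate hwlate

/-- **Crux `MonopoleCoreExclusion` (stmt-1965): at the Euler rate the anchor stub needs only late axisymmetric
witnesses.**  Binder shape of `stub_anchoredLateAxisymWitness` with `hw` replaced by late axisymmetric witnesses at
every level frequently and the Euler-rate hypothesis. [folklore] -/
theorem anchoredLateAxisymWitness_of_lateWitnesses_eulerRate {ν T : ℝ}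
    {u : ℝ → EuclideanSpace ℝ (Fin 3) → EuclideanSpace ℝ (Fin 3)}
    {p : ℝ → EuclideanSpace ℝ (Fin 3) → ℝ}
    (hν : 0 < ν) (hT : 0 < T) (hmax : IsMaximalSmoothSolution ν 0 u p T)
    (hLH : IsLerayHopfOn T ν 0 (u 0) u) (hdec : HasRapidSpatialDecay (u 0))
    (hrate : ∃ r₀ : ℝ, 0 < r₀ ∧ ∀ t ∈ Ico 0 T, ∃ x, r₀ ≤ (T - t) * ‖u t x‖)
    (hwlate : ∀ K : ℝ, 0 < K → ∀ t₀ < T, ∃ t, t₀ < t ∧ t < T ∧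
      ∃ (x₀ : EuclideanSpace ℝ (Fin 3)) (L V : ℝ)
        (Q : EuclideanSpace ℝ (Fin 3) ≃ₗᵢ[ℝ] EuclideanSpace ℝ (Fin 3))
        (W : EuclideanSpace ℝ (Fin 3) → EuclideanSpace ℝ (Fin 3)),
        0 < L ∧ 0 < V ∧ IsAxisymmetric W ∧ (∀ x, ‖u t x‖ ≤ V) ∧
        (∃ x₁, dist x₁ x₀ ≤ L ∧ V ≤ 2 * ‖u t x₁‖) ∧
        (∃ y y' : EuclideanSpace ℝ (Fin 3), ‖y‖ ≤ 1 ∧ ‖y'‖ ≤ 1 ∧ (4 : ℝ)⁻¹ ≤ ‖W y - W y'‖) ∧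
        K * ν ≤ L * V ∧
        (∀ y : EuclideanSpace ℝ (Fin 3), ‖y‖ ≤ K →
          ‖V⁻¹ • Q.symm (u t (x₀ + L • Q y)) - W y‖ ≤ K⁻¹) ∧
        (T - t) * V ≤ K * L) :
    ∃ xs : EuclideanSpace ℝ (Fin 3),
      (¬ ∃ ρ M : ℝ, 0 < ρ ∧ ∀ s ∈ Ioo (T - ρ ^ 2) T, ∀ x ∈ ball xs ρ, ‖u s x‖ ≤ M) ∧
      ∀ K : ℝ, 0 < K → ∃ t : ℝ, 0 < t ∧ t < T ∧
        ∃ (x₀ : EuclideanSpace ℝ (Fin 3)) (L V : ℝ)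
          (Q : EuclideanSpace ℝ (Fin 3) ≃ₗᵢ[ℝ] EuclideanSpace ℝ (Fin 3))
          (W : EuclideanSpace ℝ (Fin 3) → EuclideanSpace ℝ (Fin 3)),
          0 < L ∧ 0 < V ∧ IsAxisymmetric W ∧ (∀ x, ‖u t x‖ ≤ V) ∧
          (∃ x₁, dist x₁ x₀ ≤ L ∧ V ≤ 2 * ‖u t x₁‖) ∧
          (∃ y y' : EuclideanSpace ℝ (Fin 3), ‖y‖ ≤ 1 ∧ ‖y'‖ ≤ 1 ∧ (4 : ℝ)⁻¹ ≤ ‖W y - W y'‖) ∧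
          K * ν ≤ L * V ∧
          (∀ y : EuclideanSpace ℝ (Fin 3), ‖y‖ ≤ K →
            ‖V⁻¹ • Q.symm (u t (x₀ + L • Q y)) - W y‖ ≤ K⁻¹) ∧
          (T - t) * V ≤ K * L ∧ dist xs x₀ ≤ K * L / 4 :=
  anchoredLateWitness_of_lateWitnesses_eulerRate (C := IsAxisymmetric)
    (fun _ hW c _ => isAxisymmetric_dilate hW c) hν hT hmax hLH hdec hrate hwlate

end CoreExclusionAnchor

end Summit.NavierStokesRegularity.NavierStokesRegularity.Theorems

end
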